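import Summits.QuantumFields.YangMills.Theorems.BalabanUVNodesN12FlatChartHnd
import Summits.QuantumFields.YangMills.Theorems.BalabanUVNodesN12FlatCombAxialRepr
import Summits.QuantumFields.YangMills.Theorems.UnitScaleTiltProp7AxialGaugeFace
import HarnessLib

/-!
# BalabanUVNodes ∕ N12 — (β)♭ IN PRINT's OWN GAUGE `Ax_k(𝔅_k, U₀)` ([Balaban1985RegularSpaces] (1.19) p. 79): THE LINEARISED ITERATED AXIAL SLICE — level by level, the `m`-fold linearised averages are
# axial along the ONE-LEVEL combs from the next centres — IS TRANSVERSAL TO `Lie (4)` BY DOWNWARD INDUCTION ON THE LEVEL; hence the nondegeneracy ∕ positivity letter at NODE 00's flat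
# multi-scale chart holds in that gauge with no slice letter left — [Balaban1985RegularSpaces] (1.14) p. 78, (1.19) p. 79; [Balaban1985Variational] (4) p. 278, Sect. E p. 300;
# [Balaban1989LargeFieldII] (1.9) p. 358, p. 359

Cell `pub-ymgap` (HUMAN RULINGS D-0062 ∕ D-0149), WIDTH SEAT `pub-ymgap-dag-n12-w3` g2 (node N12 = [B15]; key K1⁷ `stmt-QuantumFields-20542`, `--kind proof --supports … --as helper`;
count-neutral).  THEOREMS ONLY (0 `def`, 0 `instance`, 0 `sorry`); every input CONSUMED BY NAME, nothing modified: this seat's `N12FlatChartHnd.eq_zero_of_fderiv_msChart_one_eq_zero_of_transversal`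
∕ `deriv_deriv_wilsonAction4_expChart_one_nonneg` and `N12FlatCombAxialRepr.toAdd_holT_ofAdd`; the route UnitScaleTilt's `Prop7AvgLinearisation.iterLin_grad`, `Prop7AxialGaugeFace.walkEnd_treeWord_rel`,
`B10Eq27TorusAxialLog.axialT`; `BlockAveragingEMLLinearised.walkSum_grad`.  Companion of `BalabanUVNodesN12FlatCombAxialHnd` (the route UnitScaleTilt's COMPLETE comb gauge from the
`k`-fold centres); this file treats the ITERATED, level-by-level gauge — the `-- TODO(general form)` reading flagged in `UnitScaleTiltProp7AxialGauge` — at the linearised flat level.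

THE SLICE.  For a recursion family `Q^{(·)}` of the linearised (0.4) average (`Q^{(m)}X` = the derivative of the `m`-fold average at the flat configuration, dag-n10-w1's
`N12FlatChartDerivIterLin`), a fine field `X` is ITERATED-AXIAL below `k` iff for every `m < k` and every site `x ∈ T^{(m)}` the signed sum of the level-`m` field `Q^{(m)}X` along the
one-level comb from the centre `emb (blockOf x)` of the block of `x` to `x` vanishes — written, as in the companion files, as the comb holonomy `axialT` of the `Multiplicative`-valued
field being `1`.

CONTENTS.
§1 `toAdd_axialT_ofAdd_grad` (the comb holonomy of a pure gauge `dλ` is `ofAdd (λ x − λ y)`), `axialT_ofAdd_grad_eq_one_iff` (`dλ` comb-axial from `y` to `x` ⟺ `λ x = λ y`).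
§2 ★★ `grad_eq_zero_of_iterAxial` — TRANSVERSALITY of the linearised `Ax_k`: `φ|_{k-centres} = 0` and `dφ` iterated-axial below `k` ⟹ `dφ = 0`; `Q^{(m)}(dφ) = d(φ∘embIter m)` and one-level
   axiality telescope to `φ(embIter m x) = φ(embIter (m+1) (blockOf x))`, so `φ∘embIter m = 0` descends from `m = k` to `m = 0` (matrix-valued; NO standing-range hypothesis).
§3 at NODE 00's objects, `𝔹 ⊇` all level-`k` bonds: ★★★ `eq_zero_of_fderiv_msChart_one_eq_zero_of_iterAxial` (iterated-axial `X`, `DΦ(0)X = 0`, `d²∕ds²A(e^{sX})|₀ = 0` ⟹ `X = 0`), ★★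
   `deriv_deriv_pos_of_fderiv_msChart_one_eq_zero_of_iterAxial` (POSITIVITY for `X ≠ 0`).
Second namespace `…N12FlatIterAxialRepr` (the SPANNING half — [Balaban1985RegularSpaces] p. 79 «(1.19) determine uniquely an element in each orbit», EXISTENCE, linearised):
§4 `iterBlockOf_embIter_eq_of_lt` (geometry: for `m < k ≤ m + K` a level-`m` site and the centre of its block have `m`-fold centre images in the same `k`-block — label arithmetic
   `⌊(aL^m + off)/L^k⌋ = ⌊a/L^{k−m}⌋`), `axialT_ofAdd_add_eq_one`;
§5 ★★★ `exists_centreGauge_sub_grad_iterAxial` — for `k ≤ m + K` every fine matrix-valued `X` has `ψ` vanishing at the `k`-fold centres with `Q^{(m)}(X − dψ)` one-level comb-axial for every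
   `m < k` (INDUCTION ON `k`: add the block-constant potential `z ↦ s(iterBlockOf k z)`, `s` = the level-`k` comb sums of `Q^{(k)}X`; it is invisible below `k` by §4 and vanishes at the
   `(k+1)`-fold centres).  With §2 this makes the linearised `Ax_k` a LINEAR COMPLEMENT of `Lie (4)`.

HONEST FRAMING.  Flat configuration only (`U₀ = 1`); `𝔹 ⊇` all level-`k` bonds in §3; the spanning half §5 is the LINEARISED (1.19) only (the nonlinear `-- TODO(general form)` of
`UnitScaleTiltProp7AxialGauge` stays open); no constants ((1.25)-type sup bounds of the representative are NOT here); `honto` and near-flat `U₀ ≠ 1` not treated.  Nothing of Bałaban's estimates is asserted; N12 NOT discharged;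
K1⁷ NOT closed; counts unmoved (typed 28∕28 · discharged 5∕27); one finite 𝕋⁴ programme at fixed ε — R4 closes the conditional rung `BalabanLadder.UV` only; the Yang–Mills mass gap
(Clay) is NOT proved by any of this; nothing continuum ∕ ℝ⁴ ∕ OS.
-/

noncomputable section

namespace Summit.QuantumFields.YangMills.BalabanUVNodes.N12FlatIterAxialHnd

open scoped BigOperators Matrix.Norms.L2Operator Topology
open Literature.MathematicalPhysics.QuantumFieldTheory.Balaban1983to89
open T4Continuum (T4Family walk walkEnd)
open BlockAveragingEMLLinearised (linAvg walkSum walkSum_grad)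
open T4AdjointCovarianceUnitary (lieSU)
open B15DeterminingSets
open B10Eq27TorusAxialLog (axialT holT rel)
open B7Prop1Explicit (treeWord)
open Node00
open Summit.QuantumFields.YangMills.Theorems.Prop7AxialGaugeFace (walkEnd_treeWord_rel)
open Summit.QuantumFields.YangMills.Theorems.Prop7AvgLinearisation (iterLin_grad)
open Summit.QuantumFields.YangMills.BalabanUVNodes.N12FlatCombAxialRepr (toAdd_holT_ofAdd)
open Summit.QuantumFields.YangMills.BalabanUVNodes.N12FlatChartHnd
  (eq_zero_of_fderiv_msChart_one_eq_zero_of_transversal hnd_flat_msChart_prod deriv_deriv_wilsonAction4_expChart_one_nonneg)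

/-! ## §1 One-level comb sums of a pure gauge telescope -/

section Telescope

variable {P : Params} {j : ℕ} {V : Type*} [AddCommGroup V]

/-- **The comb holonomy of a pure gauge `dλ` (read in `Multiplicative V`) from `y` to `x` is `ofAdd (λ x − λ y)`**: the signed comb sum of a gradient telescopes
(`BlockAveragingEMLLinearised.walkSum_grad`) and the comb `Γ_{y,x}` ends at `x` (`Prop7AxialGaugeFace.walkEnd_treeWord_rel`). [cite: Balaban1984PropagatorsI, (1.9)-(1.10) p.19; Balaban1985Averaging, (11) p.18] -/
theorem toAdd_axialT_ofAdd_grad (lam : Site P j → V) (y x : Site P j) :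
    Multiplicative.toAdd (axialT (fun b : PBond P j => Multiplicative.ofAdd (lam b.tgt - lam b.src)) y x) = lam x - lam y := by
  rw [axialT, toAdd_holT_ofAdd, walkSum_grad, walkEnd_treeWord_rel]

/-- Hence: `dλ` is comb-axial from `y` to `x` IFF `λ x = λ y`. [cite: Balaban1984PropagatorsI, (1.10) p.19] -/
theorem axialT_ofAdd_grad_eq_one_iff (lam : Site P j → V) (y x : Site P j) :
    axialT (fun b : PBond P j => Multiplicative.ofAdd (lam b.tgt - lam b.src)) y x = 1 ↔ lam x = lam y := by
  rw [← toAdd_eq_zero, toAdd_axialT_ofAdd_grad, sub_eq_zero]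

end Telescope

/-! ## §2 Print's ITERATED axial slice `Ax_k` is transversal to `Lie (4)` -/

section IterAxial

variable {P : Params} {n : Type*} [Fintype n] [DecidableEq n]

omit [Fintype n] [DecidableEq n] in
/-- ★★ **TRANSVERSALITY OF THE LINEARISED ITERATED AXIAL GAUGE `Ax_k(𝔅_k, 1)`** ([Balaban1985RegularSpaces] (1.19): level by level, the `m`-fold averaged configuration is axial along the
ONE-LEVEL combs from the centres of the next blocks; linearised at the flat configuration with the `linAvg`-recursion `Q^{(m)}` for the `m`-fold average): if `φ` vanishes at the `k`-fold
centres and, for every `m < k`, the level-`m` field `Q^{(m)}(dφ) = d(φ∘embIter m)` is comb-axial from the centre `emb (blockOf x)` of the block of every `x ∈ T^{(m)}`, then `dφ = 0` —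
DOWNWARD INDUCTION on the level: `φ∘embIter m (x) = φ∘embIter (m+1) (blockOf x)`. No standing-range hypothesis. [cite: Balaban1985RegularSpaces, (1.14) p.78, (1.19) p.79; Balaban1985Variational, (4) p.278] -/
theorem grad_eq_zero_of_iterAxial
    (Q : (i : ℕ) → (PBond P 0 → Matrix n n ℂ) → PBond P i → Matrix n n ℂ)
    (hQ0 : ∀ Y, Q 0 Y = Y) (hQs : ∀ (i : ℕ) (Y : PBond P 0 → Matrix n n ℂ) (c : PBond P (i + 1)), Q (i + 1) Y c = linAvg (Q i Y) c)
    (k : ℕ) (φ : Site P 0 → Matrix n n ℂ) (hφ : ∀ y : Site P k, φ (embIter k y) = 0)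
    (hax : ∀ m, m < k → ∀ x : Site P m,
      axialT (fun b : PBond P m => Multiplicative.ofAdd (Q m (fun e : PBond P 0 => φ e.tgt - φ e.src) b)) (emb (blockOf x)) x = 1) :
    ∀ b : PBond P 0, φ b.tgt - φ b.src = 0 := by
  -- `Q^{(m)}(dφ) = d(φ∘embIter m)`
  have hQgrad : ∀ m, Q m (fun e : PBond P 0 => φ e.tgt - φ e.src) = fun b : PBond P m => φ (embIter m b.tgt) - φ (embIter m b.src) := fun m =>
    funext fun b => iterLin_grad Q hQ0 hQs (fun i ψ y => ψ (embIter i y)) (fun ψ => rfl) (fun i ψ y => rfl) φ m b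
  -- downward induction on the level: `φ∘embIter m = 0` for all `m ≤ k`
  have hlevel : ∀ d m : ℕ, m + d = k → ∀ z : Site P m, φ (embIter m z) = 0 := by
    intro d
    induction d with
    | zero => intro m hm z; rw [add_zero] at hm; subst hm; exact hφ z
    | succ d ih =>
      intro m hm x
      have hmk : m < k := by omega
      have hstep := hax m hmk x
      rw [hQgrad m, axialT_ofAdd_grad_eq_one_iff (fun z : Site P m => φ (embIter m z))] at hstep
      -- `φ(embIter m x) = φ(embIter m (emb (blockOf x))) = φ(embIter (m+1) (blockOf x)) = 0`
      rw [hstep]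
      exact ih (m + 1) (by omega) (blockOf x)
  intro b
  have h0 : ∀ z : Site P 0, φ z = 0 := fun z => hlevel k 0 (zero_add k) z
  rw [h0, h0, sub_zero]

end IterAxial

/-! ## §3 At NODE 00's objects: (β)♭ in print's iterated axial gauge -/

section NodeZero

variable {F : T4Family} {N : ℕ} [NeZero N] {K k : ℕ}

/-- ★★★ **`hnd` AT THE FLAT CONFIGURATION OF NODE 00 IN THE LINEARISED ITERATED AXIAL GAUGE `Ax_k` — NO SLICE LETTER LEFT.**  `𝔹` constrains every level-`k` bond; `X` is a fine `𝔰𝔲(N)`-field whose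
`m`-fold linearised averages `Q^{(m)}↑X` (`m < k`, any recursion family `Q^{(·)}`) are comb-axial along the one-level combs from the next centres; `DΦ(0)X = 0` for the flat multi-scale chart and
`d²∕ds² A(e^{sX})|₀ = 0` ⟹ `X = 0`. [cite: Balaban1985RegularSpaces, (1.19) p.79; Balaban1989LargeFieldII, (1.9) p.358, p.359; Balaban1985Variational, Sect. E p.300] -/
theorem eq_zero_of_fderiv_msChart_one_eq_zero_of_iterAxial
    (Q : (i : ℕ) → (PBond (F.P K) 0 → Matrix (Fin N) (Fin N) ℂ) → PBond (F.P K) i → Matrix (Fin N) (Fin N) ℂ)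
    (hQ0 : ∀ Y, Q 0 Y = Y) (hQs : ∀ (i : ℕ) (Y : PBond (F.P K) 0 → Matrix (Fin N) (Fin N) ℂ) (c : PBond (F.P K) (i + 1)), Q (i + 1) Y c = linAvg (Q i Y) c)
    (𝔹 : DetSet (F.P K)) (h𝔹 : ∀ c : PBond (F.P K) k, c ∈ bondsOf (𝔹 k))
    {X : PBond (F.P K) 0 → lieSU (Fin N)}
    (hax : ∀ m, m < k → ∀ x : Site (F.P K) m,
      axialT (fun b : PBond (F.P K) m => Multiplicative.ofAdd (Q m (fun e => (X e : Matrix (Fin N) (Fin N) ℂ)) b)) (emb (blockOf x)) x = 1)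
    (hker : fderiv ℝ (msChart F N K k 𝔹 (avgFamily (avOfRecord F N K) (1 : GaugeField (F.P K) 0 (SU N))) (1 : GaugeField (F.P K) 0 (SU N))) 0 X = 0)
    (hflat : deriv (deriv fun s : ℝ => wilsonAction4 (expChart (1 : GaugeField (F.P K) 0 (SU N)) (s • X))) 0 = 0) :
    X = 0 := by
  have hS : ∀ φ : Site (F.P K) 0 → lieSU (Fin N), (∀ y : Site (F.P K) k, φ (embIter k y) = 0) →
      (fun b : PBond (F.P K) 0 => φ b.tgt - φ b.src) ∈
        {Y : PBond (F.P K) 0 → lieSU (Fin N) | ∀ m, m < k → ∀ x : Site (F.P K) m,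
          axialT (fun b : PBond (F.P K) m => Multiplicative.ofAdd (Q m (fun e => (Y e : Matrix (Fin N) (Fin N) ℂ)) b)) (emb (blockOf x)) x = 1} →
      ∀ b : PBond (F.P K) 0, φ b.tgt - φ b.src = 0 := by
    intro φ hφ hmem b
    have hmat := grad_eq_zero_of_iterAxial Q hQ0 hQs k (fun z => (φ z : Matrix (Fin N) (Fin N) ℂ))
      (fun y => by rw [hφ y, ZeroMemClass.coe_zero]) (fun m hm x => by
        have h := hmem m hm x
        simp only [Submodule.coe_sub] at h
        exact h) b
    exact Subtype.ext (by rw [Submodule.coe_sub, hmat, ZeroMemClass.coe_zero])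
  exact eq_zero_of_fderiv_msChart_one_eq_zero_of_transversal 𝔹 h𝔹 hS hax hker hflat

/-- ★★ **POSITIVITY FORM IN THE ITERATED AXIAL GAUGE**: `X ≠ 0` iterated-axial with `DΦ(0)X = 0` ⟹ `0 < d²∕ds² A(e^{sX})|₀`. [cite: Balaban1989LargeFieldII, (1.9) p.358, p.359; Balaban1985RegularSpaces, (1.19) p.79] -/
theorem deriv_deriv_pos_of_fderiv_msChart_one_eq_zero_of_iterAxial
    (Q : (i : ℕ) → (PBond (F.P K) 0 → Matrix (Fin N) (Fin N) ℂ) → PBond (F.P K) i → Matrix (Fin N) (Fin N) ℂ)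
    (hQ0 : ∀ Y, Q 0 Y = Y) (hQs : ∀ (i : ℕ) (Y : PBond (F.P K) 0 → Matrix (Fin N) (Fin N) ℂ) (c : PBond (F.P K) (i + 1)), Q (i + 1) Y c = linAvg (Q i Y) c)
    (𝔹 : DetSet (F.P K)) (h𝔹 : ∀ c : PBond (F.P K) k, c ∈ bondsOf (𝔹 k))
    {X : PBond (F.P K) 0 → lieSU (Fin N)} (hX0 : X ≠ 0)
    (hax : ∀ m, m < k → ∀ x : Site (F.P K) m,
      axialT (fun b : PBond (F.P K) m => Multiplicative.ofAdd (Q m (fun e => (X e : Matrix (Fin N) (Fin N) ℂ)) b)) (emb (blockOf x)) x = 1)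
    (hker : fderiv ℝ (msChart F N K k 𝔹 (avgFamily (avOfRecord F N K) (1 : GaugeField (F.P K) 0 (SU N))) (1 : GaugeField (F.P K) 0 (SU N))) 0 X = 0) :
    0 < deriv (deriv fun s : ℝ => wilsonAction4 (expChart (1 : GaugeField (F.P K) 0 (SU N)) (s • X))) 0 :=
  lt_of_le_of_ne (deriv_deriv_wilsonAction4_expChart_one_nonneg X) fun h =>
    hX0 (eq_zero_of_fderiv_msChart_one_eq_zero_of_iterAxial Q hQ0 hQs 𝔹 h𝔹 hax hker h.symm)

end NodeZero

end Summit.QuantumFields.YangMills.BalabanUVNodes.N12FlatIterAxialHnd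

end

noncomputable section

namespace Summit.QuantumFields.YangMills.BalabanUVNodes.N12FlatIterAxialRepr

open scoped BigOperators Matrix.Norms.L2Operator Topology
open Literature.MathematicalPhysics.QuantumFieldTheory.Balaban1983to89
open T4Continuum (T4Family walk walkEnd)
open BlockAveragingEMLLinearised (linAvg walkSum walkSum_grad)
open B15DeterminingSets
open B5Eq118OneStroke (iterBlockOf iterBlockOf_succ val_iterBlockOf)
open B10Eq27TorusAxialLog (axialT holT rel)
open B7Prop1Explicit (treeWord)
open Literature.MathematicalPhysics.QuantumFieldTheory.BalabanImbrieJaffe1984to88.BIJ88RT51Background (iterBlockOf_embIter)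
open Summit.QuantumFields.YangMills.Theorems.Prop7CombGauge (iterLin_add walkSum_add val_embIter_eq)
open Summit.QuantumFields.YangMills.Theorems.Prop7AvgLinearisation (iterLin_grad)
open Summit.QuantumFields.YangMills.BalabanUVNodes.N12FlatCombAxialRepr (toAdd_holT_ofAdd axialT_ofAdd_eq_one_iff)
open Summit.QuantumFields.YangMills.BalabanUVNodes.N12FlatIterAxialHnd (toAdd_axialT_ofAdd_grad axialT_ofAdd_grad_eq_one_iff)
open Summit.QuantumFields.YangMills.Theorems.Prop7AxialGaugeFace (walkEnd_treeWord_rel)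

variable {P : Params}

/-! ## §1 Geometry: a level-`m` site and the centre of its block lie over the same `k`-block, `m < k` -/

/-- **Sites of one `(m+1)`-block have `m`-fold centre images in the same `k`-block** (`m < k ≤ m + K`, labels: `⌊(aL^m + off)/L^k⌋ = ⌊a/L^{k−m}⌋ = ⌊⌊a/L⌋/L^{k−m−1}⌋`): for `x ∈ T^{(m)}`
the fine sites `embIter m x` and `embIter m (emb (blockOf x))` have the same image under `iterBlockOf k`. [cite: Balaban1987RG1, (0.1)-(0.3) pp.251-252] -/
theorem iterBlockOf_embIter_eq_of_lt {m k : ℕ} (hk : k ≤ P.m + P.K) (hmk : m < k) (x : Site P m) :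
    iterBlockOf k (embIter m x) = iterBlockOf k (embIter m (emb (blockOf x))) := by
  have hm : m ≤ P.m + P.K := by omega
  have hm1 : m + 1 ≤ P.m + P.K := by omega
  have hL : 0 < P.L := P.L_pos
  have hLm : 0 < P.L ^ m := pow_pos hL m
  funext μ
  apply ZMod.val_injective
  rw [val_iterBlockOf k hk, val_iterBlockOf k hk]
  obtain ⟨off, hoff, hle⟩ := val_embIter_eq m hm x μ
  obtain ⟨off', hoff', hle'⟩ := val_embIter_eq m hm (emb (blockOf x)) μ
  rw [hoff, hoff', Site.val_emb hm1, Site.val_blockOf hm1]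
  -- `L^k = L^m · L · L^{k−m−1}`
  obtain ⟨e, rfl⟩ : ∃ e, k = m + 1 + e := ⟨k - (m + 1), by omega⟩
  have hpow : P.L ^ (m + 1 + e) = P.L ^ m * (P.L * P.L ^ e) := by rw [pow_add, pow_succ]; ring
  have hoffL : off < P.L ^ m := by omega
  have hoffL' : off' < P.L ^ m := by omega
  have h2 : (P.L - 1) / 2 < P.L := by have := P.hL.2; omega
  rw [hpow, ← Nat.div_div_eq_div_mul, ← Nat.div_div_eq_div_mul, ← Nat.div_div_eq_div_mul, ← Nat.div_div_eq_div_mul]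
  congr 1
  rw [mul_comm ((x μ).val) (P.L ^ m), Nat.mul_add_div hLm, Nat.div_eq_of_lt hoffL, add_zero,
    mul_comm (((x μ).val / P.L * P.L + (P.L - 1) / 2)) (P.L ^ m), Nat.mul_add_div hLm, Nat.div_eq_of_lt hoffL', add_zero,
    mul_comm ((x μ).val / P.L) P.L, Nat.mul_add_div hL, Nat.div_eq_of_lt h2, add_zero]

/-! ## §2 Existence of ITERATED-AXIAL representatives inside `Lie (4)` (the linearised (1.19) gauge fixing) -/

section Repr

variable {n : Type*} [Fintype n] [DecidableEq n]

omit [Fintype n] [DecidableEq n] in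
/-- One-level comb-axiality is additive in the field (any base point). [cite: Balaban1985RegularSpaces, (1.19) p.79 (bookkeeping)] -/
theorem axialT_ofAdd_add_eq_one {j : ℕ} {V : Type*} [AddCommGroup V] {Y Z : PBond P j → V} {y x : Site P j}
    (hY : axialT (fun b : PBond P j => Multiplicative.ofAdd (Y b)) y x = 1) (hZ : axialT (fun b : PBond P j => Multiplicative.ofAdd (Z b)) y x = 1) :
    axialT (fun b : PBond P j => Multiplicative.ofAdd (Y b + Z b)) y x = 1 := by
  refine (axialT_ofAdd_eq_one_iff (fun b => Y b + Z b) _ _).2 ?_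
  rw [walkSum_add, (axialT_ofAdd_eq_one_iff Y _ _).1 hY, (axialT_ofAdd_eq_one_iff Z _ _).1 hZ, add_zero]

omit [Fintype n] [DecidableEq n] in
/-- ★★★ **EVERY FINE FIELD HAS AN ITERATED-AXIAL REPRESENTATIVE MODULO `Lie (4)`** — [Balaban1985RegularSpaces] p. 79 «The conditions (1.19) determine uniquely an element in each orbit given by
the subgroup (1.14)», EXISTENCE half, linearised at the flat configuration: for `k ≤ m + K` and every fine matrix-valued `X` there is `ψ` vanishing at the `k`-fold centres such that for every
`m < k` the level-`m` field `Q^{(m)}(X − dψ)` is comb-axial along the one-level combs from the centres `emb (blockOf x)`, `x ∈ T^{(m)}`.  INDUCTION ON `k`: given the representative below `k`,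
the level-`k` condition is met by adding the block-constant potential `δ(z) = s(iterBlockOf k z)`, `s(x)` = the comb sum of `Q^{(k)}X` from `emb (blockOf x)` to `x`; `δ` is invisible at
the levels `m < k` (§1) and vanishes at the `(k+1)`-fold centres (`Site.blockOf_emb`, `axialT_self`). [cite: Balaban1985RegularSpaces, (1.14) p.78, (1.19) p.79; Balaban1985Variational, (16)-(18) p.280] -/
theorem exists_centreGauge_sub_grad_iterAxial
    (Q : (i : ℕ) → (PBond P 0 → Matrix n n ℂ) → PBond P i → Matrix n n ℂ)
    (hQ0 : ∀ Y, Q 0 Y = Y) (hQs : ∀ (i : ℕ) (Y : PBond P 0 → Matrix n n ℂ) (c : PBond P (i + 1)), Q (i + 1) Y c = linAvg (Q i Y) c) :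
    ∀ k : ℕ, k ≤ P.m + P.K → ∀ X : PBond P 0 → Matrix n n ℂ, ∃ ψ : Site P 0 → Matrix n n ℂ, (∀ y : Site P k, ψ (embIter k y) = 0) ∧
      ∀ m, m < k → ∀ x : Site P m,
        axialT (fun b : PBond P m => Multiplicative.ofAdd (Q m (fun e : PBond P 0 => X e - (ψ e.tgt - ψ e.src)) b)) (emb (blockOf x)) x = 1 := by
  intro k
  induction k with
  | zero =>
    intro _ X
    exact ⟨fun _ => 0, fun y => rfl, fun m hm => absurd hm (Nat.not_lt_zero m)⟩
  | succ k ih =>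
    intro hk1 X
    have hk : k ≤ P.m + P.K := Nat.le_of_succ_le hk1
    obtain ⟨ψ₁, hψ₁, hax₁⟩ := ih hk X
    -- the level-`k` comb sums of `Q^{(k)}X` and the block-constant correction (opaque names)
    obtain ⟨s, hs⟩ : ∃ s : Site P k → Matrix n n ℂ,
        ∀ x, s x = Multiplicative.toAdd (axialT (fun b : PBond P k => Multiplicative.ofAdd (Q k X b)) (emb (blockOf x)) x) := ⟨_, fun _ => rfl⟩
    obtain ⟨δ, hδ⟩ : ∃ δ : Site P 0 → Matrix n n ℂ, ∀ z, δ z = s (iterBlockOf k z) := ⟨_, fun _ => rfl⟩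
    -- `Q^{(m)}` of the corrected field: old part plus the pure gauge of `−δ` read at the `m`-fold centres
    have hQm : ∀ (m : ℕ) (b : PBond P m), Q m (fun e : PBond P 0 => X e - ((ψ₁ e.tgt + δ e.tgt) - (ψ₁ e.src + δ e.src))) b =
        Q m (fun e : PBond P 0 => X e - (ψ₁ e.tgt - ψ₁ e.src)) b + (-δ (embIter m b.tgt) - -δ (embIter m b.src)) := by
      intro m b
      have hsplit : (fun e : PBond P 0 => X e - ((ψ₁ e.tgt + δ e.tgt) - (ψ₁ e.src + δ e.src))) =
          fun e => (X e - (ψ₁ e.tgt - ψ₁ e.src)) + ((fun z => -δ z) e.tgt - (fun z => -δ z) e.src) := by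
        funext e; simp only; abel
      have hg := iterLin_grad Q hQ0 hQs (fun i φ y => φ (embIter i y)) (fun φ => rfl) (fun i φ y => rfl) (fun z => -δ z) m b
      rw [hsplit, iterLin_add Q hQ0 hQs, hg]
    -- at the centres-vanishing `ψ₁`, `Q^{(k)}(X − dψ₁) = Q^{(k)}X`
    have hQk : ∀ b : PBond P k, Q k (fun e : PBond P 0 => X e - (ψ₁ e.tgt - ψ₁ e.src)) b = Q k X b := fun b => by
      have hsp : (fun e : PBond P 0 => X e - (ψ₁ e.tgt - ψ₁ e.src)) = fun e => X e + ((fun z => -ψ₁ z) e.tgt - (fun z => -ψ₁ z) e.src) := by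
        funext e; simp only; abel
      have hg := iterLin_grad Q hQ0 hQs (fun i φ y => φ (embIter i y)) (fun φ => rfl) (fun i φ y => rfl) (fun z => -ψ₁ z) k b
      rw [hsp, iterLin_add Q hQ0 hQs, hg]
      simp only [hψ₁, neg_zero, sub_self, add_zero]
    refine ⟨fun z => ψ₁ z + δ z, fun y => ?_, fun m hm x => ?_⟩
    · -- vanishing at the `(k+1)`-fold centres
      show ψ₁ (embIter k (emb y)) + δ (embIter k (emb y)) = 0
      rw [hψ₁, zero_add, hδ, iterBlockOf_embIter k hk, hs, Site.blockOf_emb hk1, B10Eq27TorusAxialLog.axialT_self, toAdd_one]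
    · have hfun : (fun b : PBond P m => Multiplicative.ofAdd (Q m (fun e : PBond P 0 => X e - ((ψ₁ e.tgt + δ e.tgt) - (ψ₁ e.src + δ e.src))) b)) =
          fun b => Multiplicative.ofAdd (Q m (fun e : PBond P 0 => X e - (ψ₁ e.tgt - ψ₁ e.src)) b +
            ((fun z => -δ (embIter m z)) b.tgt - (fun z => -δ (embIter m z)) b.src)) := funext fun b => by rw [hQm]
      show axialT (fun b : PBond P m => Multiplicative.ofAdd (Q m (fun e : PBond P 0 => X e - ((ψ₁ e.tgt + δ e.tgt) - (ψ₁ e.src + δ e.src))) b))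
        (emb (blockOf x)) x = 1
      rw [hfun]
      rcases Nat.lt_succ_iff_lt_or_eq.1 hm with hlt | heq
      · -- levels below `k`: the old representative is axial there and `δ` is constant on the relevant pair of sites (§1)
        refine axialT_ofAdd_add_eq_one (hax₁ m hlt x) ?_
        refine (axialT_ofAdd_grad_eq_one_iff (fun z => -δ (embIter m z)) _ _).2 ?_
        show -δ (embIter m x) = -δ (embIter m (emb (blockOf x)))
        rw [hδ, hδ, iterBlockOf_embIter_eq_of_lt hk hlt x]
      · -- level `k`: the comb sum of `Q^{(k)}X − ds` from a centre is `s(centre) = 0`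
        subst heq
        refine (axialT_ofAdd_eq_one_iff _ _ _).2 ?_
        have h1 : walkSum (Q m (fun e : PBond P 0 => X e - (ψ₁ e.tgt - ψ₁ e.src))) (walk (emb (blockOf x)) (treeWord (rel (emb (blockOf x)) x))) = s x := by
          rw [show Q m (fun e : PBond P 0 => X e - (ψ₁ e.tgt - ψ₁ e.src)) = Q m X from funext hQk, hs, axialT, toAdd_holT_ofAdd]
        have h2 := walkSum_grad (fun z => -δ (embIter m z)) (emb (blockOf x))
          (treeWord (rel (emb (blockOf x)) x) : List (T4Continuum.Letter P.d))
        rw [walkEnd_treeWord_rel] at h2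
        rw [walkSum_add, h1, h2, hδ, hδ, iterBlockOf_embIter m hk, iterBlockOf_embIter m hk, hs (emb (blockOf x)), Site.blockOf_emb hk1,
          B10Eq27TorusAxialLog.axialT_self, toAdd_one]
        abel

end Repr

end Summit.QuantumFields.YangMills.BalabanUVNodes.N12FlatIterAxialRepr

end
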